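import Mathlib
import Literature.Computability.AlgebraicComplexity.MignonRessayreBound
import Literature.Algebra.Polynomial.JacobianCriterion
import Summits.ValiantsHypothesis.ValiantsHypothesis.Theorems.GrenetZeonTwoDimCoefficientsDefs
import Summits.ValiantsHypothesis.ValiantsHypothesis.Theorems.GrenetZeonTwoDimCoefficientsDualUnipotentNormalForm
import Summits.ValiantsHypothesis.ValiantsHypothesis.Theorems.GrenetZeonTwoDimCoefficientsStubUnitDichotomy

/-!
# Crux `GrenetZeon.TwoDimCoefficients` (stmt-ValiantsHypothesis-8062), stub `stub_dualUnipotent`: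
# the permanent of order three has no unipotent dual representation of size three

The line card of `dim2_cases` names as CHEAPEST FALSIFIER of the open stub `stub_dualUnipotent`
(`DualUnipotentBound`) the exact unipotent-trace width of `per_3`: the least `m` with
`DualUnipotentRepr 3 m` (`per_3 = α·det A + β·tr(adj A · B)`, `A`, `B` affine `m × m`,
`det A ≡ c ≠ 0`), to be compared with `dc(per_3) = 7`.  The tree gave only `m ≥ 3` at `n = 3`
(`le_of_hasDim2Repr`; the flatness rung `2n² ≤ m² + 4n`).  This file proves `m ≥ 4`:

* `two_mul_finrank_le_of_bilinForm_isOrtho` — a subspace that is totally isotropic for a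
  non-degenerate bilinear form on `V` has `2·dim ≤ dim V` (the matrix case is the tree's
  `two_mul_finrank_le_of_isOrtho`, `…StubUnitDichotomy.lean`, reused below);
* `two_mul_finrank_le_sq_of_hess0_perPoly_isOrtho` — hence a linear subspace `K` of `n × n`
  matrices (`n ≥ 3`) that is totally isotropic for the Hessian of `per_n` at the Mignon–Ressayre
  point (in particular: at every point, i.e. `per_n` affine along every coset of `K`) has
  `2·dim K ≤ n²` — the Hessian there is `(n−3)! · mrHess`, non-degenerate (tree:
  `hess0_transl_mrPoint_perPoly`, `mrHess_mulVec_injective`).  This complements the tree's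
  `finrank_le_of_hess0_perPoly_isOrtho` (`dim K ≤ 2n`, better for `n ≥ 5`) at `n = 3, 4`;
* `sq_le_of_dualUnipotentRepr_isotropy` — `DualUnipotentRepr n m`, `n ≥ 3` ⟹
  `n² ≤ ⌊m²/2⌋ + ⌊n²/2⌋`: by the nilpotent-pencil normal form `per_n = tr(N^{n−1} M)`
  (`exists_nilpotent_pencil_of_dualUnipotentRepr`), the directional derivatives of the linear
  pencil `N` span a subspace of `m × m` matrices that is totally isotropic for the trace form
  (`tr(N²) = 0` since `N` is nilpotent; differentiate twice), so it has dimension `≤ m²/2`, while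
  its kernel `K` (directions killing `N`) is a second-order flat of `per_n` (`∂_u ∂_v tr(N^k M) = 0`
  for `u, v ∈ K`), so `dim K ≤ n²/2`; rank–nullity;
* `not_dualUnipotentRepr_three_three` — `¬ DualUnipotentRepr 3 3` (`9 ≤ 4 + 4` fails): the
  unipotent-trace width of `per_3` is at least `4` (and at most `7`, Grenet/Laplace).

HONEST FRAMING: a small-case calibration of an open-problem-grade stub (which asks `n² ≤ C·m`);
nothing here bears on the stub itself beyond `n = 3`, and `VP ≠ VNP` is not moved by anything in
this file.

References: T. Mignon, N. Ressayre, Int. Math. Res. Not. 2004:79, §3 (the point and its Hessian);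
J. M. Landsberg, *Geometry and Complexity Theory* (2017), Lemma 6.4.6.3.
-/

-- single-conjunct layout `Summits/ValiantsHypothesis/ValiantsHypothesis`: the duplicated namespace
-- component is mandated by the tree.
set_option linter.dupNamespace false

noncomputable section

namespace Summit.ValiantsHypothesis.ValiantsHypothesis.Cruxes.TwoDimCoefficients.DimTwoCases

open MvPolynomial Matrix
open Literature.Computability.AlgebraicComplexity

/-! ### Totally isotropic subspaces of non-degenerate forms -/

section Isotropic

/-- A subspace totally isotropic for a non-degenerate bilinear form on a finite-dimensional
space `V` has `2·dim ≤ dim V` (it is contained in its own orthogonal complement, whose dimension is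
the codimension). [folklore] -/
theorem two_mul_finrank_le_of_bilinForm_isOrtho {K V : Type*} [Field K] [AddCommGroup V]
    [Module K V]
    [FiniteDimensional K V] (B : LinearMap.BilinForm K V) (hB : B.Nondegenerate)
    (W : Submodule K V) (hW : ∀ u ∈ W, ∀ v ∈ W, B u v = 0) :
    2 * Module.finrank K W ≤ Module.finrank K V := by
  have hle : W ≤ B.orthogonal W := fun v hv =>
    LinearMap.BilinForm.mem_orthogonal_iff.2 fun u hu => hW u hu v hv
  have h1 := Submodule.finrank_mono hle
  rw [LinearMap.BilinForm.finrank_orthogonal hB W] at h1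
  have h2 := Submodule.finrank_le W
  omega

/-- The trace form `(P, Q) ↦ tr(P·Q)` on square matrices over a field is non-degenerate, so a
subspace of `ι × ι` matrices on which all `tr(P·Q)` vanish has `2·dim ≤ |ι|²`. [folklore] -/
theorem two_mul_finrank_le_card_sq_of_trace_mul_eq_zero {K : Type*} [Field K] {ι : Type*}
    [Fintype ι] [DecidableEq ι] (W : Submodule K (Matrix ι ι K))
    (hW : ∀ P ∈ W, ∀ Q ∈ W, (P * Q).trace = 0) :
    2 * Module.finrank K W ≤ Fintype.card ι ^ 2 := by
  let τ : LinearMap.BilinForm K (Matrix ι ι K) :=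
    (LinearMap.mul K (Matrix ι ι K)).compr₂ (Matrix.traceLinearMap ι K K)
  have hτ : ∀ P Q, τ P Q = (P * Q).trace := fun P Q => rfl
  have hnd : τ.Nondegenerate := by
    refine ⟨fun P hP => ?_, fun Q hQ => ?_⟩
    · exact (Matrix.ext_iff_trace_mul_right (A := P) (B := 0)).2 fun x => by
        rw [Matrix.zero_mul, Matrix.trace_zero, ← hτ]; exact hP x
    · exact (Matrix.ext_iff_trace_mul_left (A := Q) (B := 0)).2 fun x => by
        rw [Matrix.mul_zero, Matrix.trace_zero, ← hτ]; exact hQ x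
  have h := two_mul_finrank_le_of_bilinForm_isOrtho τ hnd W fun u hu v hv => by
    rw [hτ]; exact hW u hu v hv
  rwa [Module.finrank_matrix, Module.finrank_self, mul_one, ← sq] at h

end Isotropic

/-! ### Second-order flats of the permanent have `2·dim ≤ n²` -/

section PermanentFlatHalf

/-- **A subspace totally isotropic for the Hessian of `per_{m+3}` at the Mignon–Ressayre point has
`2·dim ≤ (m+3)²`:** that Hessian is `m! · mrHess`, which is non-degenerate
(Mignon–Ressayre 2004, §3; Landsberg 2017, Lemma 6.4.6.3; the isotropy count is the tree's
`two_mul_finrank_le_of_isOrtho`). [folklore] -/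
theorem two_mul_finrank_le_sq_of_isOrtho_hess0_mrPoint {m : ℕ}
    (K : Submodule ℂ (Fin (m + 3) × Fin (m + 3) → ℂ))
    (hK : ∀ u ∈ K, ∀ v ∈ K, Matrix.toBilin'
      (hess0 (transl (mrPoint ℂ m) (perPoly (Fin (m + 3)) ℂ))) u v = 0) :
    2 * Module.finrank ℂ K ≤ (m + 3) ^ 2 := by
  set H := hess0 (transl (mrPoint ℂ m) (perPoly (Fin (m + 3)) ℂ)) with hHdef
  have hH : H = (m.factorial : ℂ) • mrHess ℂ m := hess0_transl_mrPoint_perPoly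
  have hdet : H.det ≠ 0 := by
    rw [hH, Matrix.det_smul]
    refine mul_ne_zero (pow_ne_zero _ (Nat.cast_ne_zero.2 (Nat.factorial_ne_zero m))) ?_
    have hu : IsUnit (mrHess ℂ m) :=
      Matrix.mulVec_injective_iff_isUnit.mp mrHess_mulVec_injective
    exact ((Matrix.isUnit_iff_isUnit_det _).mp hu).ne_zero
  have h := two_mul_finrank_le_of_isOrtho H hdet K hK
  rwa [Fintype.card_prod, Fintype.card_fin, ← sq] at h

/-- **Second-order flats of the permanent have `2·dim ≤ n²`.** If a linear subspace `K` of `n × n`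
matrices (`n ≥ 3`) is totally isotropic for the Hessian of `per_n` at every point (equivalently:
`per_n` is affine along every coset `x + K`), then `2·dim K ≤ n²`.  Companion of the tree's
`finrank_le_of_hess0_perPoly_isOrtho` (`dim K ≤ 2n`); sharper exactly for `n = 3`. [folklore] -/
theorem two_mul_finrank_le_sq_of_hess0_perPoly_isOrtho {n : ℕ} (hn : 3 ≤ n)
    (K : Submodule ℂ (Fin n × Fin n → ℂ))
    (hK : ∀ p : Fin n × Fin n → ℂ, ∀ u ∈ K, ∀ v ∈ K,
      Matrix.toBilin' (hess0 (transl p (perPoly (Fin n) ℂ))) u v = 0) :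
    2 * Module.finrank ℂ K ≤ n ^ 2 := by
  obtain ⟨m, rfl⟩ : ∃ m, n = m + 3 := ⟨n - 3, by omega⟩
  exact two_mul_finrank_le_sq_of_isOrtho_hess0_mrPoint K (hK _)

end PermanentFlatHalf

/-! ### Derivations applied entrywise to matrices -/

section MatrixDerivation

variable {R A : Type*} [CommRing R] [CommRing A] [Algebra R A] {ι : Type*}

/-- Leibniz rule for a derivation applied entrywise to a product of matrices. [folklore] -/
theorem map_mul_derivation [Fintype ι] (D : Derivation R A A) (P Q : Matrix ι ι A) :
    (P * Q).map D = P.map D * Q + P * Q.map D := by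
  ext i j
  simp only [Matrix.map_apply, Matrix.mul_apply, Matrix.add_apply, map_sum, Derivation.leibniz,
    smul_eq_mul, Finset.sum_add_distrib]
  rw [add_comm]
  congr 1
  exact Finset.sum_congr rfl fun k _ => mul_comm _ _

/-- A derivation kills the identity matrix. [folklore] -/
theorem map_one_derivation [DecidableEq ι] (D : Derivation R A A) :
    (1 : Matrix ι ι A).map D = 0 := by
  ext i j
  by_cases hij : i = j
  · subst hij; simp
  · simp [Matrix.one_apply_ne hij]

/-- If a derivation kills a matrix entrywise, it kills all its powers. [folklore] -/
theorem map_pow_derivation_eq_zero [Fintype ι] [DecidableEq ι] (D : Derivation R A A)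
    {P : Matrix ι ι A} (hP : P.map D = 0) (k : ℕ) : (P ^ k).map D = 0 := by
  induction k with
  | zero => rw [pow_zero]; exact map_one_derivation D
  | succ k ih => rw [pow_succ, map_mul_derivation, ih, hP, Matrix.zero_mul, Matrix.mul_zero, add_zero]

/-- A derivation commutes with the trace. [folklore] -/
theorem derivation_trace [Fintype ι] (D : Derivation R A A) (P : Matrix ι ι A) :
    D P.trace = (P.map D).trace :=
  AddMonoidHom.map_trace D P

/-- A derivation kills matrices of scalars. [folklore] -/
theorem map_algebraMap_derivation (D : Derivation R A A) (G : Matrix ι ι R) :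
    (G.map (algebraMap R A)).map D = 0 := by
  ext i j
  simp

end MatrixDerivation

/-! ### Directional derivatives of polynomials and the Hessian bilinear form -/

section Directional

variable {σ : Type*}

/-- The directional derivative `∂_u = Σ_s u_s ∂_s` as a derivation of the polynomial ring.
(An abbreviation inside statements; no new definition is introduced.) [folklore] -/
theorem sum_smul_pderiv_apply [Fintype σ] (u : σ → ℂ) (f : MvPolynomial σ ℂ) :
    (∑ s, u s • (pderiv s : Derivation ℂ (MvPolynomial σ ℂ) (MvPolynomial σ ℂ))) f =
      ∑ s, u s • pderiv s f := by
  rw [← Derivation.coeFnAddMonoidHom_apply, map_sum, Finset.sum_apply]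
  simp [Derivation.smul_apply]

/-- A form of degree `0` is a constant. [folklore] -/
theorem eq_C_of_isHomogeneous_zero {f : MvPolynomial σ ℂ} (hf : f.IsHomogeneous 0) :
    f = C (constantCoeff f) := by
  have h0 : f.totalDegree = 0 := Nat.le_zero.1 hf.totalDegree_le
  rw [constantCoeff_eq]
  exact totalDegree_eq_zero_iff_eq_C.1 h0

/-- The directional derivative of a linear form is a constant. [folklore] -/
theorem isHomogeneous_zero_sum_smul_pderiv [Fintype σ] (u : σ → ℂ) {f : MvPolynomial σ ℂ}
    (hf : f.IsHomogeneous 1) :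
    ((∑ s, u s • (pderiv s : Derivation ℂ (MvPolynomial σ ℂ) (MvPolynomial σ ℂ))) f).IsHomogeneous
      0 := by
  rw [sum_smul_pderiv_apply]
  refine IsHomogeneous.sum _ _ _ fun s _ => ?_
  rw [smul_eq_C_mul]
  exact (Literature.Algebra.Polynomial.JacobianCriterion.isHomogeneous_pderiv hf s).C_mul _

/-- **The Hessian bilinear form is the iterated directional derivative:**
`vᵀ · Hess f(p) · u = (∂_v ∂_u f)(p)`. [folklore] -/
theorem toBilin'_hess0_transl_eq_eval [Fintype σ] [DecidableEq σ] (p v u : σ → ℂ)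
    (f : MvPolynomial σ ℂ) :
    Matrix.toBilin' (hess0 (transl p f)) v u =
      eval p ((∑ s, v s • (pderiv s : Derivation ℂ (MvPolynomial σ ℂ) (MvPolynomial σ ℂ)))
        ((∑ t, u t • (pderiv t : Derivation ℂ (MvPolynomial σ ℂ) (MvPolynomial σ ℂ))) f)) := by
  rw [Matrix.toBilin'_apply, sum_smul_pderiv_apply, sum_smul_pderiv_apply, map_sum]
  refine Finset.sum_congr rfl fun s _ => ?_
  rw [smul_eval, map_sum, map_sum, Finset.mul_sum]
  refine Finset.sum_congr rfl fun t _ => ?_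
  rw [Derivation.map_smul, smul_eval, hess0_transl]
  ring

end Directional

/-! ### The linear pencil of a unipotent dual representation -/

section Pencil

variable {σ : Type*} {m : ℕ}

/-- For a matrix `N` of linear forms and a derivation `D` lowering linear forms to constants
(e.g. a directional derivative `Σ_s u_s ∂_s`): `D N` is the matrix of scalars `(D N)(0)`.
[folklore] -/
theorem map_derivation_eq_map_C (D : Derivation ℂ (MvPolynomial σ ℂ) (MvPolynomial σ ℂ))
    (hD : ∀ f : MvPolynomial σ ℂ, f.IsHomogeneous 1 → (D f).IsHomogeneous 0)
    {N : Matrix (Fin m) (Fin m) (MvPolynomial σ ℂ)} (hN : ∀ i j, (N i j).IsHomogeneous 1) :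
    N.map D = (N.map fun f => constantCoeff (D f)).map (algebraMap ℂ (MvPolynomial σ ℂ)) := by
  refine Matrix.ext fun i j => ?_
  rw [Matrix.map_apply, Matrix.map_apply, Matrix.map_apply, MvPolynomial.algebraMap_eq]
  exact eq_C_of_isHomogeneous_zero (hD _ (hN i j))

/-- **Trace isotropy of a nilpotent linear pencil.** If `N` is a nilpotent matrix of linear forms
and `D₁`, `D₂` are derivations lowering linear forms to constants, the matrices of scalars
`G_i = D_i N` satisfy `tr(G₁ · G₂) = 0`: indeed `tr(N²) = 0` identically and
`D₂ D₁ tr(N²) = 2·tr(G₁ G₂)`. [folklore] -/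
theorem trace_mul_eq_zero_of_pencil {N : Matrix (Fin m) (Fin m) (MvPolynomial σ ℂ)}
    (hN : ∀ i j, (N i j).IsHomogeneous 1) (hNil : N ^ m = 0)
    (D₁ D₂ : Derivation ℂ (MvPolynomial σ ℂ) (MvPolynomial σ ℂ))
    (hD₁ : ∀ f : MvPolynomial σ ℂ, f.IsHomogeneous 1 → (D₁ f).IsHomogeneous 0)
    (hD₂ : ∀ f : MvPolynomial σ ℂ, f.IsHomogeneous 1 → (D₂ f).IsHomogeneous 0) :
    ((N.map fun f => constantCoeff (D₁ f)) * (N.map fun f => constantCoeff (D₂ f))).trace = 0 := by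
  set G₁ : Matrix (Fin m) (Fin m) ℂ := N.map fun f => constantCoeff (D₁ f) with hG₁
  set G₂ : Matrix (Fin m) (Fin m) ℂ := N.map fun f => constantCoeff (D₂ f) with hG₂
  have hN₁ : N.map D₁ = G₁.map (algebraMap ℂ (MvPolynomial σ ℂ)) := map_derivation_eq_map_C D₁ hD₁ hN
  have hN₂ : N.map D₂ = G₂.map (algebraMap ℂ (MvPolynomial σ ℂ)) := map_derivation_eq_map_C D₂ hD₂ hN
  -- `tr(N²) = 0`
  have hsq : (N * N).trace = 0 := by
    have hnil : IsNilpotent (N * N) :=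
      ⟨m, by rw [← sq, ← pow_mul, pow_mul', hNil, zero_pow two_ne_zero]⟩
    exact (Matrix.isNilpotent_trace_of_isNilpotent hnil).eq_zero
  -- differentiate twice
  have h1 : D₁ (N * N).trace = (G₁.map (algebraMap ℂ (MvPolynomial σ ℂ)) * N +
      N * G₁.map (algebraMap ℂ (MvPolynomial σ ℂ))).trace := by
    rw [derivation_trace, map_mul_derivation, hN₁]
  have h2 : D₂ (D₁ (N * N).trace) =
      (G₁.map (algebraMap ℂ (MvPolynomial σ ℂ)) * G₂.map (algebraMap ℂ (MvPolynomial σ ℂ)) +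
        G₂.map (algebraMap ℂ (MvPolynomial σ ℂ)) * G₁.map (algebraMap ℂ (MvPolynomial σ ℂ))).trace := by
    rw [h1, derivation_trace, Matrix.map_add (⇑D₂) (map_add D₂), map_mul_derivation,
      map_mul_derivation, map_algebraMap_derivation, hN₂, Matrix.zero_mul, zero_add,
      Matrix.mul_zero, add_zero]
  rw [hsq, map_zero, map_zero] at h2
  have h3 : (algebraMap ℂ (MvPolynomial σ ℂ)) ((G₁ * G₂).trace + (G₂ * G₁).trace) = 0 := by
    rw [map_add, AddMonoidHom.map_trace (algebraMap ℂ (MvPolynomial σ ℂ)) (G₁ * G₂),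
      AddMonoidHom.map_trace (algebraMap ℂ (MvPolynomial σ ℂ)) (G₂ * G₁), Matrix.map_mul,
      Matrix.map_mul, ← Matrix.trace_add]
    exact h2.symm
  rw [Matrix.trace_mul_comm G₂ G₁, ← two_mul, MvPolynomial.algebraMap_eq, C_eq_zero] at h3
  exact (mul_eq_zero.1 h3).resolve_left two_ne_zero

/-- **Flatness of the kernel of the pencil.** If the derivations `D₁`, `D₂` kill the pencil `N`
entrywise and `D₁` lowers the linear forms of `M` to constants, then `D₂ D₁ tr(N^k · M) = 0`.
[folklore] -/
theorem derivation_derivation_trace_pow_mul {N M : Matrix (Fin m) (Fin m) (MvPolynomial σ ℂ)}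
    (hM : ∀ i j, (M i j).IsHomogeneous 1) (k : ℕ)
    (D₁ D₂ : Derivation ℂ (MvPolynomial σ ℂ) (MvPolynomial σ ℂ))
    (hD₁ : ∀ f : MvPolynomial σ ℂ, f.IsHomogeneous 1 → (D₁ f).IsHomogeneous 0)
    (h₁ : N.map D₁ = 0) (h₂ : N.map D₂ = 0) :
    D₂ (D₁ (N ^ k * M).trace) = 0 := by
  set G : Matrix (Fin m) (Fin m) ℂ := M.map fun f => constantCoeff (D₁ f) with hG
  have hMG : M.map D₁ = G.map (algebraMap ℂ (MvPolynomial σ ℂ)) := map_derivation_eq_map_C D₁ hD₁ hM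
  rw [derivation_trace, map_mul_derivation, map_pow_derivation_eq_zero D₁ h₁ k, Matrix.zero_mul,
    zero_add, hMG, derivation_trace, map_mul_derivation, map_pow_derivation_eq_zero D₂ h₂ k,
    map_algebraMap_derivation, Matrix.zero_mul, Matrix.mul_zero, add_zero, Matrix.trace_zero]

end Pencil

/-! ### The bound and the case `(n, m) = (3, 3)` -/

section Bound

/-- **Isotropy bound for unipotent dual representations.** If `per_n` (`n ≥ 3`) has a unipotent
dual representation of size `m`, then `n² ≤ ⌊m²/2⌋ + ⌊n²/2⌋`.  Proof: in the normal form
`per_n = tr(N^{n−1} M)` the map `u ↦ ∂_u N` has image totally isotropic for the trace form on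
`m × m` matrices (`2·rank ≤ m²`) and kernel a second-order flat of `per_n` (`2·dim ≤ n²`, the
Hessian at the Mignon–Ressayre point being non-degenerate); rank–nullity. [folklore] -/
theorem sq_le_of_dualUnipotentRepr_isotropy {n m : ℕ} (hn : 3 ≤ n) (h : DualUnipotentRepr n m) :
    n ^ 2 ≤ m ^ 2 / 2 + n ^ 2 / 2 := by
  obtain ⟨N, M, hN, hM, hNil, hper⟩ := exists_nilpotent_pencil_of_dualUnipotentRepr (by omega) h
  -- the derivative of the pencil, as a linear map
  let D : (Fin n × Fin n → ℂ) → Derivation ℂ (MvPolynomial (Fin n × Fin n) ℂ)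
      (MvPolynomial (Fin n × Fin n) ℂ) := fun u => ∑ s, u s • (pderiv s : Derivation ℂ
        (MvPolynomial (Fin n × Fin n) ℂ) (MvPolynomial (Fin n × Fin n) ℂ))
  have hDadd : ∀ u v, D (u + v) = D u + D v := fun u v => by
    simp only [D, Pi.add_apply, add_smul, Finset.sum_add_distrib]
  have hDsmul : ∀ (c : ℂ) u, D (c • u) = c • D u := fun c u => by
    simp only [D, Pi.smul_apply, smul_eq_mul, mul_smul, Finset.smul_sum]
  let Φ : (Fin n × Fin n → ℂ) →ₗ[ℂ] Matrix (Fin m) (Fin m) ℂ :=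
    { toFun := fun u => N.map fun f => constantCoeff (D u f)
      map_add' := fun u v => by
        ext i j
        simp only [Matrix.map_apply, Matrix.add_apply, hDadd, Derivation.add_apply, map_add]
      map_smul' := fun c u => by
        ext i j
        simp only [Matrix.map_apply, Matrix.smul_apply, hDsmul, Derivation.smul_apply,
          RingHom.id_apply, smul_eq_mul, constantCoeff_smul] }
  have hΦ : ∀ u, Φ u = N.map fun f => constantCoeff (D u f) := fun u => rfl
  have hD0 : ∀ u (f : MvPolynomial (Fin n × Fin n) ℂ), f.IsHomogeneous 1 →
      (D u f).IsHomogeneous 0 := fun u f hf => isHomogeneous_zero_sum_smul_pderiv u hf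
  -- image: totally isotropic for the trace form
  have hrange : 2 * Module.finrank ℂ (LinearMap.range Φ) ≤ m ^ 2 := by
    have h := two_mul_finrank_le_card_sq_of_trace_mul_eq_zero (LinearMap.range Φ) ?_
    · simpa [Fintype.card_fin] using h
    rintro P ⟨u, rfl⟩ Q ⟨v, rfl⟩
    rw [hΦ, hΦ]
    exact trace_mul_eq_zero_of_pencil hN hNil (D u) (D v) (hD0 u) (hD0 v)
  -- kernel: a second-order flat of the permanent
  have hker : 2 * Module.finrank ℂ (LinearMap.ker Φ) ≤ n ^ 2 := by
    refine two_mul_finrank_le_sq_of_hess0_perPoly_isOrtho hn _ fun p u hu v hv => ?_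
    have hu' : N.map (D u) = 0 := by
      rw [map_derivation_eq_map_C (D u) (hD0 u) hN, ← hΦ, LinearMap.mem_ker.1 hu]
      exact Matrix.map_zero _ (map_zero (algebraMap ℂ (MvPolynomial (Fin n × Fin n) ℂ)))
    have hv' : N.map (D v) = 0 := by
      rw [map_derivation_eq_map_C (D v) (hD0 v) hN, ← hΦ, LinearMap.mem_ker.1 hv]
      exact Matrix.map_zero _ (map_zero (algebraMap ℂ (MvPolynomial (Fin n × Fin n) ℂ)))
    rw [toBilin'_hess0_transl_eq_eval p u v (perPoly (Fin n) ℂ), hper,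
      derivation_derivation_trace_pow_mul hM (n - 1) (D v) (D u) (hD0 v) hv' hu', map_zero]
  -- rank–nullity
  have hsum : Module.finrank ℂ (LinearMap.range Φ) + Module.finrank ℂ (LinearMap.ker Φ) = n ^ 2 := by
    rw [LinearMap.finrank_range_add_finrank_ker Φ, Module.finrank_fintype_fun_eq_card,
      Fintype.card_prod, Fintype.card_fin, sq]
  have h1 : Module.finrank ℂ (LinearMap.range Φ) ≤ m ^ 2 / 2 :=
    (Nat.le_div_iff_mul_le two_pos).2 (by omega)
  have h2 : Module.finrank ℂ (LinearMap.ker Φ) ≤ n ^ 2 / 2 :=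
    (Nat.le_div_iff_mul_le two_pos).2 (by omega)
  omega

/-- **The permanent of order `3` has no unipotent dual representation of size `3`**
(`9 ≤ ⌊9/2⌋ + ⌊9/2⌋ = 8` fails): the unipotent-trace width of `per_3` is at least `4` (the tree's
bounds `le_of_hasDim2Repr`, `2n² ≤ m² + 4n` allowed `m = 3`).  Upper bound in the model: `7`
(Laplace expansion as a single-source branching program; `dc(per_3) = 7`). [folklore] -/
theorem not_dualUnipotentRepr_three_three : ¬ DualUnipotentRepr 3 3 := by
  intro h
  have := sq_le_of_dualUnipotentRepr_isotropy le_rfl h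
  norm_num at this

/-- For odd `n ≥ 3` there is no unipotent dual representation of `per_n` of size exactly `n`
(`n² ≤ 2⌊n²/2⌋ = n² − 1` fails); for `n ≥ 5` this is weaker than the flatness rung, for `n = 3`
it is `not_dualUnipotentRepr_three_three`. [folklore] -/
theorem not_dualUnipotentRepr_self_of_odd {n : ℕ} (hn : 3 ≤ n) (hodd : Odd n) :
    ¬ DualUnipotentRepr n n := by
  intro h
  have hle := sq_le_of_dualUnipotentRepr_isotropy hn h
  obtain ⟨k, rfl⟩ := hodd
  have hsq : (2 * k + 1) ^ 2 / 2 = 2 * k ^ 2 + 2 * k := by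
    have : (2 * k + 1) ^ 2 = 2 * (2 * k ^ 2 + 2 * k) + 1 := by ring
    rw [this]; omega
  rw [hsq] at hle
  nlinarith

end Bound

end Summit.ValiantsHypothesis.ValiantsHypothesis.Cruxes.TwoDimCoefficients.DimTwoCases

end
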